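import Literature.NumberTheory.LFunctions.ZetaClassicalRegionBounds
import Mathlib.Analysis.SpecialFunctions.Pow.Asymptotics
import Mathlib.Analysis.SpecialFunctions.ImproperIntegrals
import Mathlib.MeasureTheory.Integral.Bochner.Basic
import Mathlib.MeasureTheory.Integral.Bochner.Set
import Mathlib.MeasureTheory.Measure.Lebesgue.Integral
import Mathlib.Analysis.Complex.RealDeriv
import HarnessLib

/-!
# Goldston–Pintz–Yıldırım, *Primes in tuples I*, Lemma 1: the contour `ℒ` and the bound (5.6)–(5.7)

Trunk: NumberTheory / Sieve. The first of the "Two Lemmas" of §5 of D. A. Goldston, J. Pintz,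
C. Y. Yıldırım, *Primes in tuples. I*, Ann. of Math. 170 (2009) (arXiv:math/0508185, p. 11): the
estimate for `∫_ℒ (log(|s|+3))^B |R^s/s^k ds|` along the contour `ℒ : s = −c̄/log(|t|+3) + it`
of (5.5), to which the contours `(1)` are moved in the proofs of (6.18) and Lemma 3 (§8). Together
with `Literature.NumberTheory.LFunctions.ZetaClassicalRegionBounds` ((5.3)–(5.4), imported: the
same `c̄`) and `GoldstonPintzYildirimDivisorSums` (Lemma 2) this completes §5. Everything is PROVED.

* `Literature.GPY.contourL c̄ t = s(t)`, `Literature.GPY.contourLSpeed c̄ t = |s'(t)|` (`norm_deriv_contourL`),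
  `Literature.GPY.lemma1Integral c̄ R B k = ∫_ℒ (log(|s|+3))^B |R^s/s^k| |ds|` ((5.5)–(5.6));
* `Literature.NumberTheory.Sieve.GPY.lemma1Integrand_integrable` — the integrand is Bochner integrable on `ℝ` (so the integral
  below is the convergent integral of the source, and `‖∫_ℒ F R^s s^{-k} ds‖ ≤ sup|F| · ∫_ℒ …` is
  available downstream);
* `Literature.NumberTheory.Sieve.GPY.lemma1_bound` — **Lemma 1, (5.6)**: for `0 < c̄ ≤ 10⁻²`, `C > 0` there are `C₁ ≥ 1`,
  `c₂ > 0`, `K > 0` with `∫_ℒ … ≤ K (C₁^k R^{−c₂} + e^{−√(c̄ log R)/2})` whenever `R ≥ C`, `k ≥ 2`,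
  `0 ≤ B ≤ Ck`;
* `Literature.NumberTheory.Sieve.GPY.lemma1_bound_of_le_log` — **(5.7)**: if moreover `k ≤ c₃ log R` (`c₃ = c₃(C, c̄) > 0`),
  `∫_ℒ … ≤ K e^{−√(c̄ log R)/2}`.

Proof as printed ((5.8)): `|ds/dt| ≤ 2`, `log(|s|+3) ≤ log(|t|+4)`, `|s| ≥ max(|t|, c̄/log(|t|+3))`;
on `|t| ≤ C₄` the integrand is `≤ 2 C₁^k R^{−c₂}` (`c₂ = c̄/log(C₄+3)`), on `|t| > C₄` it is
`≤ 2 R^{σ(t)} |t|^{−3/2}` once `(2 log u)^C ≤ u^{1/4}` (`u ≥ C₄(C)`), and `R^{σ(t)} ≤ R^{−c̄/log ω}`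
for `|t| ≤ ω − 3`, `≤ 1` beyond; with `log ω = √(c̄ log R)` the three ranges give
`C₁^k R^{−c₂} + e^{−√(c̄ log R)} + ω^{−1/2}`. The measure-theoretic form is a comparison with an
explicit integrable majorant on `(0, ∞)` (`setIntegral_Ioi_le_of_majorant`), so no integrability of
the integrand is needed; (5.7) follows from (5.6) by maximising `√(c̄L)/2 − c₂L/2 ≤ c̄/(8c₂)`.

## References

* D. A. Goldston, J. Pintz, C. Y. Yıldırım, *Primes in tuples. I*, Ann. of Math. (2) 170 (2009),
  819–862 = arXiv:math/0508185, §5, (5.5)–(5.8), Lemma 1, p. 11. [cite: GoldstonPintzYildirim2009]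
-/

noncomputable section

open Real MeasureTheory Set Filter Asymptotics

namespace Literature.NumberTheory.Sieve.GPY


/-- GPY (5.5): the contour `ℒ`, `s(t) = −c̄/log(|t| + 3) + it` (`t ∈ ℝ`), along which the
contour integrals of §§6–8 are estimated; `c̄` is the constant of (5.3)
(`Literature.NumberTheory.LFunctions.ZetaClassicalRegion.exists_zeroFreeRegion_bounds`), so that `ℒ + 1` lies in the zero-free
region `σ ≥ 1 − 4c̄/log(|t|+3)`. [cite: GoldstonPintzYildirim2009, Section 5 eq. 5.5] -/
def contourL (cbar t : ℝ) : ℂ := ⟨-(cbar / Real.log (|t| + 3)), t⟩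

/-- The speed `|ds/dt| = √(1 + (c̄/((|t|+3) log²(|t|+3)))²)` of the parametrisation of `ℒ` by
`t = Im s` (`norm_deriv_contourL`), the density of the arc-length measure `|ds|` of Lemma 1.
[cite: GoldstonPintzYildirim2009, Section 5 eq. 5.5] -/
def contourLSpeed (cbar t : ℝ) : ℝ :=
  Real.sqrt (1 + (cbar / ((|t| + 3) * Real.log (|t| + 3) ^ 2)) ^ 2)

/-- The integrand of GPY Lemma 1 pulled back to the parameter `t`:
`(log(|s|+3))^B · |R^s/s^k| · |ds/dt|` with `s = s(t) ∈ ℒ` (`|R^s| = R^{Re s}` for `R > 0`).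
[cite: GoldstonPintzYildirim2009, Lemma 1 eq. 5.6] -/
def lemma1Integrand (cbar R B : ℝ) (k : ℕ) (t : ℝ) : ℝ :=
  Real.log (‖contourL cbar t‖ + 3) ^ B * (R ^ (contourL cbar t).re / ‖contourL cbar t‖ ^ k) *
    contourLSpeed cbar t

/-- The left-hand side of GPY Lemma 1, (5.6)–(5.7): `∫_ℒ (log(|s|+3))^B |R^s/s^k ds|`, as the
Bochner integral over `t ∈ ℝ` of `lemma1Integrand` (nonnegative and integrable,
`lemma1Integrand_integrable`, so this is the convergent integral of the source).
[cite: GoldstonPintzYildirim2009, Lemma 1 eq. 5.6] -/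
def lemma1Integral (cbar R B : ℝ) (k : ℕ) : ℝ := ∫ t : ℝ, lemma1Integrand cbar R B k t

variable {cbar : ℝ}

/-- `Re s(t) = −c̄/log(|t|+3)`. [folklore] -/
theorem contourL_re (cbar t : ℝ) : (contourL cbar t).re = -(cbar / Real.log (|t| + 3)) := rfl
/-- `Im s(t) = t`. [folklore] -/
theorem contourL_im (cbar t : ℝ) : (contourL cbar t).im = t := rfl

/-- `|t| ≤ |s(t)|`. [folklore] -/
theorem abs_le_norm_contourL (cbar t : ℝ) : |t| ≤ ‖contourL cbar t‖ := by
  simpa [contourL_im] using Complex.abs_im_le_norm (contourL cbar t)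

/-- `c̄/log(|t|+3) ≤ |s(t)|` (`c̄ ≥ 0`). [folklore] -/
theorem div_log_le_norm_contourL (hc : 0 ≤ cbar) (t : ℝ) :
    cbar / Real.log (|t| + 3) ≤ ‖contourL cbar t‖ := by
  have h := Complex.abs_re_le_norm (contourL cbar t)
  have hnn : 0 ≤ cbar / Real.log (|t| + 3) :=
    div_nonneg hc (by linarith [LFunctions.ZetaClassicalRegion.one_lt_log_abs_add_three t])
  rwa [contourL_re, abs_neg, abs_of_nonneg hnn] at h

/-- `s(t) ≠ 0`: `|s(t)| > 0` for `c̄ > 0`. [folklore] -/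
theorem norm_contourL_pos (hc : 0 < cbar) (t : ℝ) : 0 < ‖contourL cbar t‖ :=
  lt_of_lt_of_le (div_pos hc (by linarith [LFunctions.ZetaClassicalRegion.one_lt_log_abs_add_three t]))
    (div_log_le_norm_contourL hc.le t)

/-- `|s(t)| ≤ |t| + 1` for `0 ≤ c̄ ≤ 1`. [folklore] -/
theorem norm_contourL_le (hc : 0 ≤ cbar) (hc1 : cbar ≤ 1) (t : ℝ) :
    ‖contourL cbar t‖ ≤ |t| + 1 := by
  have h := Complex.norm_le_abs_re_add_abs_im (contourL cbar t)
  rw [contourL_re, contourL_im, abs_neg] at h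
  have hL := LFunctions.ZetaClassicalRegion.one_lt_log_abs_add_three t
  have h2 : |cbar / Real.log (|t| + 3)| ≤ 1 := by
    rw [abs_of_nonneg (div_nonneg hc (by linarith))]
    rw [div_le_one (by linarith)]
    linarith
  linarith

/-- `log(|s(t)|+3) ≤ log(|t|+4)` (the `log(|t|+4)` of GPY (5.8)).
[cite: GoldstonPintzYildirim2009, Lemma 1 eq. 5.8] -/
theorem log_norm_contourL_add_three_le (hc : 0 ≤ cbar) (hc1 : cbar ≤ 1) (t : ℝ) :
    Real.log (‖contourL cbar t‖ + 3) ≤ Real.log (|t| + 4) := by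
  have := norm_contourL_le hc hc1 t
  exact Real.log_le_log (by linarith [norm_nonneg (contourL cbar t)]) (by linarith)

/-- `1 < log(|s(t)|+3)`. [folklore] -/
theorem one_lt_log_norm_contourL_add_three (cbar t : ℝ) : 1 < Real.log (‖contourL cbar t‖ + 3) :=
  (LFunctions.ZetaClassicalRegion.one_lt_log_abs_add_three 0 |>.trans_le (by
    refine Real.log_le_log (by norm_num) ?_
    simp [norm_nonneg]))

/-- `|ds/dt| ≤ 2` (indeed `≤ √2`) for `0 ≤ c̄ ≤ 1`: the arc-length measure on `ℒ` is comparable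
with `dt`, as used in (5.8). [folklore] -/
theorem contourLSpeed_le_two (hc : 0 ≤ cbar) (hc1 : cbar ≤ 1) (t : ℝ) :
    contourLSpeed cbar t ≤ 2 := by
  unfold contourLSpeed
  have hL := LFunctions.ZetaClassicalRegion.one_lt_log_abs_add_three t
  have hx : cbar / ((|t| + 3) * Real.log (|t| + 3) ^ 2) ≤ 1 := by
    rw [div_le_one (by positivity)]
    have : (1 : ℝ) ≤ (|t| + 3) * Real.log (|t| + 3) ^ 2 := by
      have h1 : (3 : ℝ) ≤ |t| + 3 := by linarith [abs_nonneg t]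
      have h2 : (1 : ℝ) ≤ Real.log (|t| + 3) ^ 2 := by nlinarith
      nlinarith
    linarith
  have hx0 : 0 ≤ cbar / ((|t| + 3) * Real.log (|t| + 3) ^ 2) := by positivity
  rw [Real.sqrt_le_left (by norm_num)]
  nlinarith

/-- `0 ≤ |ds/dt|`. [folklore] -/
theorem contourLSpeed_nonneg (cbar t : ℝ) : 0 ≤ contourLSpeed cbar t := Real.sqrt_nonneg _

/-- The parametrisation `t ↦ s(t)` of `ℒ` is differentiable on `t > 0` with
`s'(t) = c̄/((t+3) log²(t+3)) + i`. [folklore] -/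
theorem hasDerivAt_contourL (cbar : ℝ) {t : ℝ} (ht : 0 < t) :
    HasDerivAt (fun u : ℝ => contourL cbar u)
      (((cbar / ((t + 3) * Real.log (t + 3) ^ 2) : ℝ) : ℂ) + Complex.I) t := by
  have hlog : HasDerivAt (fun u : ℝ => Real.log (u + 3)) (1 / (t + 3)) t := by
    have h := ((hasDerivAt_id' t).add_const 3).log (by linarith)
    simpa using h
  have hL : Real.log (t + 3) ≠ 0 := (Real.log_pos (by linarith)).ne'
  have hσ0 : HasDerivAt (fun u : ℝ => -cbar * (Real.log (u + 3))⁻¹)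
      (-cbar * (-(1 / (t + 3)) / Real.log (t + 3) ^ 2)) t := (hlog.inv hL).const_mul (-cbar)
  have hσ : HasDerivAt (fun u : ℝ => -cbar * (Real.log (u + 3))⁻¹)
      (cbar / ((t + 3) * Real.log (t + 3) ^ 2)) t :=
    hσ0.congr_deriv (by field_simp)
  have hC : HasDerivAt (fun u : ℝ => ((-cbar * (Real.log (u + 3))⁻¹ : ℝ) : ℂ) + (u : ℂ) * Complex.I)
      (((cbar / ((t + 3) * Real.log (t + 3) ^ 2) : ℝ) : ℂ) + Complex.I) t := by
    refine hσ.ofReal_comp.add ?_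
    have := (hasDerivAt_id' t).ofReal_comp.mul_const Complex.I
    simpa using this
  have heq : (fun u : ℝ => ((-cbar * (Real.log (u + 3))⁻¹ : ℝ) : ℂ) + (u : ℂ) * Complex.I)
      =ᶠ[nhds t] fun u : ℝ => contourL cbar u := by
    filter_upwards [lt_mem_nhds ht] with u hu
    apply Complex.ext
    · simp only [Complex.add_re, Complex.ofReal_re, Complex.mul_re, Complex.ofReal_im,
        Complex.I_re, Complex.I_im, contourL, abs_of_pos hu]
      ring
    · simp [contourL]
  exact hC.congr_of_eventuallyEq heq.symm

/-- `|s'(t)| = contourLSpeed c̄ t` for `t > 0` (both sides are even in `t`), identifying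
`lemma1Integral` with the arc-length integral `∫_ℒ … |ds|` of Lemma 1. [folklore] -/
theorem norm_deriv_contourL (cbar : ℝ) {t : ℝ} (ht : 0 < t) :
    ‖deriv (fun u : ℝ => contourL cbar u) t‖ = contourLSpeed cbar t := by
  rw [(hasDerivAt_contourL cbar ht).deriv, contourLSpeed, abs_of_pos ht]
  set a : ℝ := cbar / ((t + 3) * Real.log (t + 3) ^ 2) with ha
  rw [Complex.norm_eq_sqrt_sq_add_sq]
  have hre : (((a : ℝ) : ℂ) + Complex.I).re = a := by simp
  have him : (((a : ℝ) : ℂ) + Complex.I).im = 1 := by simp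
  rw [hre, him]
  congr 1
  ring

/-- The integrand of Lemma 1 is nonnegative (`R ≥ 0`). [folklore] -/
theorem lemma1Integrand_nonneg (cbar : ℝ) {R : ℝ} (hR : 0 ≤ R) (B : ℝ) (k : ℕ) (t : ℝ) :
    0 ≤ lemma1Integrand cbar R B k t := by
  unfold lemma1Integrand
  have h1 : 0 ≤ Real.log (‖contourL cbar t‖ + 3) := by
    linarith [one_lt_log_norm_contourL_add_three cbar t]
  have h2 : 0 ≤ R ^ (contourL cbar t).re := Real.rpow_nonneg hR _
  have h3 := contourLSpeed_nonneg cbar t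
  positivity

/-- On `ℒ`, `R^{Re s} ≤ 1` for `R ≥ 1`. [folklore] -/
theorem rpow_re_le_one {R : ℝ} (hR : 1 ≤ R) (hc : 0 ≤ cbar) (t : ℝ) :
    R ^ (contourL cbar t).re ≤ 1 := by
  apply Real.rpow_le_one_of_one_le_of_nonpos hR
  rw [contourL_re, neg_nonpos]
  exact div_nonneg hc (by linarith [LFunctions.ZetaClassicalRegion.one_lt_log_abs_add_three t])

/-- On `ℒ` with `|t| ≤ T` and `R ≥ 1`: `R^{Re s(t)} ≤ R^{−c̄/log(T+3)}` (the factors `R^{−c₂}` and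
`R^{−c̄/log ω}` of (5.8)). [cite: GoldstonPintzYildirim2009, Lemma 1 eq. 5.8] -/
theorem rpow_re_le_of_abs_le {R : ℝ} (hR : 1 ≤ R) (hc : 0 ≤ cbar) {t T : ℝ} (ht : |t| ≤ T) :
    R ^ (contourL cbar t).re ≤ R ^ (-(cbar / Real.log (T + 3))) := by
  apply Real.rpow_le_rpow_of_exponent_le hR
  rw [contourL_re, neg_le_neg_iff]
  have hL := LFunctions.ZetaClassicalRegion.one_lt_log_abs_add_three t
  exact div_le_div_of_nonneg_left hc (by linarith)
    (Real.log_le_log (by linarith [abs_nonneg t]) (by linarith))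

/-- On `ℒ` with `0 < R ≤ 1`: `R^{Re s(t)} ≤ R^{−c̄/log 3}`. [folklore] -/
theorem rpow_re_le_of_le_one {R : ℝ} (hR0 : 0 < R) (hR : R ≤ 1) (hc : 0 ≤ cbar) (t : ℝ) :
    R ^ (contourL cbar t).re ≤ R ^ (-(cbar / Real.log 3)) := by
  apply Real.rpow_le_rpow_of_exponent_ge hR0 hR
  rw [contourL_re, neg_le_neg_iff]
  have h3 : 1 < Real.log 3 := by
    have := LFunctions.ZetaClassicalRegion.one_lt_log_abs_add_three 0
    simpa using this
  exact div_le_div_of_nonneg_left hc (by linarith)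
    (Real.log_le_log (by norm_num) (by linarith [abs_nonneg t]))



/-- `∫_c^∞ u^{−3/2} du = 2/√c` (`c > 0`). [folklore] -/
theorem integral_Ioi_rpow_neg_three_halves {c : ℝ} (hc : 0 < c) :
    ∫ u in Ioi c, u ^ (-(3 / 2 : ℝ)) = 2 / Real.sqrt c := by
  rw [integral_Ioi_rpow_of_lt (by norm_num) hc]
  have h1 : -(3 / 2 : ℝ) + 1 = -(1 / 2) := by norm_num
  rw [h1, Real.rpow_neg hc.le, ← Real.sqrt_eq_rpow]
  ring

/-- The three-range bookkeeping of (5.8): a nonnegative function on `(0, ∞)` bounded by `a` on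
`(0, C₄]`, by `b u^{−3/2}` on `(C₄, ω']` and by `(b + d) u^{−3/2}` beyond `ω'` has integral at most
`a C₄ + 2b/√C₄ + 2d/√ω'` (comparison with an integrable majorant; no integrability of the function
itself is needed). [cite: GoldstonPintzYildirim2009, Lemma 1 eq. 5.8] -/
theorem setIntegral_Ioi_le_of_majorant {F : ℝ → ℝ} (hF0 : ∀ u, 0 < u → 0 ≤ F u)
    {a b d C₄ ω' : ℝ} (hC₄ : 0 < C₄) (hω' : C₄ ≤ ω')
    (h1 : ∀ u, 0 < u → u ≤ C₄ → F u ≤ a)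
    (h2 : ∀ u, C₄ < u → u ≤ ω' → F u ≤ b * u ^ (-(3 / 2 : ℝ)))
    (h3 : ∀ u, ω' < u → F u ≤ (b + d) * u ^ (-(3 / 2 : ℝ))) :
    ∫ u in Ioi 0, F u ≤ a * C₄ + 2 * b / Real.sqrt C₄ + 2 * d / Real.sqrt ω' := by
  have hω'0 : 0 < ω' := hC₄.trans_le hω'
  set r : ℝ := -(3 / 2 : ℝ) with hr
  -- the three pieces of the majorant
  set G₁ : ℝ → ℝ := (Iic C₄).indicator fun _ => a with hG₁
  set G₂ : ℝ → ℝ := (Ioi C₄).indicator fun u => b * u ^ r with hG₂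
  set G₃ : ℝ → ℝ := (Ioi ω').indicator fun u => d * u ^ r with hG₃
  -- integrability on `(0, ∞)`
  have hI₁ : Integrable G₁ (volume.restrict (Ioi (0 : ℝ))) := by
    rw [hG₁, integrable_indicator_iff measurableSet_Iic]
    refine integrableOn_const ?_
    rw [Measure.restrict_apply measurableSet_Iic]
    have : volume (Iic C₄ ∩ Ioi (0 : ℝ)) < ⊤ := by
      calc volume (Iic C₄ ∩ Ioi (0 : ℝ)) ≤ volume (Ioc (0 : ℝ) C₄) := by
            apply measure_mono
            intro x hx
            exact ⟨hx.2, hx.1⟩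
        _ < ⊤ := by rw [Real.volume_Ioc]; exact ENNReal.ofReal_lt_top
    exact this.ne
  have hrpow : IntegrableOn (fun u : ℝ => u ^ r) (Ioi C₄) :=
    integrableOn_Ioi_rpow_of_lt (by norm_num) hC₄
  have hrpow' : IntegrableOn (fun u : ℝ => u ^ r) (Ioi ω') :=
    integrableOn_Ioi_rpow_of_lt (by norm_num) hω'0
  have hI₂ : Integrable G₂ (volume.restrict (Ioi (0 : ℝ))) := by
    rw [hG₂, integrable_indicator_iff measurableSet_Ioi]
    have : IntegrableOn (fun u : ℝ => b * u ^ r) (Ioi C₄) := hrpow.const_mul b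
    exact this.mono_measure (Measure.restrict_le_self)
  have hI₃ : Integrable G₃ (volume.restrict (Ioi (0 : ℝ))) := by
    rw [hG₃, integrable_indicator_iff measurableSet_Ioi]
    have : IntegrableOn (fun u : ℝ => d * u ^ r) (Ioi ω') := hrpow'.const_mul d
    exact this.mono_measure (Measure.restrict_le_self)
  -- pointwise domination on `(0, ∞)`
  have hdom : ∀ u ∈ Ioi (0 : ℝ), F u ≤ G₁ u + G₂ u + G₃ u := by
    intro u hu
    have hu0 : 0 < u := hu
    have hur : 0 ≤ u ^ r := Real.rpow_nonneg hu0.le _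
    simp only [hG₁, hG₂, hG₃, Set.indicator_apply, Set.mem_Iic, Set.mem_Ioi]
    rcases le_or_gt u C₄ with h | h
    · rw [if_pos h, if_neg (not_lt.2 h), if_neg (not_lt.2 (h.trans hω'))]
      simpa using h1 u hu0 h
    · rw [if_neg (not_le.2 h), if_pos h]
      rcases le_or_gt u ω' with h' | h'
      · rw [if_neg (not_lt.2 h')]
        have := h2 u h h'
        linarith
      · rw [if_pos h']
        have := h3 u h'
        linarith
  -- integrate
  have hmono : ∫ u in Ioi 0, F u ≤ ∫ u in Ioi 0, (G₁ u + G₂ u + G₃ u) := by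
    refine integral_mono_of_nonneg ?_ ((hI₁.add hI₂).add hI₃) ?_
    · exact ae_restrict_of_forall_mem measurableSet_Ioi fun u hu => hF0 u hu
    · exact ae_restrict_of_forall_mem measurableSet_Ioi hdom
  have hsplit : ∫ u in Ioi 0, (G₁ u + G₂ u + G₃ u) =
      (∫ u in Ioi 0, G₁ u) + (∫ u in Ioi 0, G₂ u) + ∫ u in Ioi 0, G₃ u := by
    have e1 := integral_add (hI₁.add hI₂) hI₃
    have e2 := integral_add hI₁ hI₂
    simp only [Pi.add_apply] at e1 e2
    rw [e1, e2]
  -- evaluate the three integrals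
  have hE₁ : ∫ u in Ioi 0, G₁ u ≤ a * C₄ := by
    rw [hG₁, integral_indicator measurableSet_Iic, Measure.restrict_restrict measurableSet_Iic,
      setIntegral_const]
    have hsub : Iic C₄ ∩ Ioi (0 : ℝ) = Ioc 0 C₄ := by
      ext x; simp [and_comm]
    rw [hsub, Real.volume_real_Ioc_of_le hC₄.le, smul_eq_mul]
    linarith [mul_comm (C₄ - 0) a]
  have hE₂ : ∫ u in Ioi 0, G₂ u = 2 * b / Real.sqrt C₄ := by
    rw [hG₂, integral_indicator measurableSet_Ioi, Measure.restrict_restrict measurableSet_Ioi]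
    have hsub : Ioi C₄ ∩ Ioi (0 : ℝ) = Ioi C₄ := by
      ext x; simp only [Set.mem_inter_iff, Set.mem_Ioi]; constructor
      · exact fun h => h.1
      · exact fun h => ⟨h, hC₄.trans h⟩
    rw [hsub, integral_const_mul, integral_Ioi_rpow_neg_three_halves hC₄]
    ring
  have hE₃ : ∫ u in Ioi 0, G₃ u = 2 * d / Real.sqrt ω' := by
    rw [hG₃, integral_indicator measurableSet_Ioi, Measure.restrict_restrict measurableSet_Ioi]
    have hsub : Ioi ω' ∩ Ioi (0 : ℝ) = Ioi ω' := by
      ext x; simp only [Set.mem_inter_iff, Set.mem_Ioi]; constructor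
      · exact fun h => h.1
      · exact fun h => ⟨h, hω'0.trans h⟩
    rw [hsub, integral_const_mul, integral_Ioi_rpow_neg_three_halves hω'0]
    ring
  calc ∫ u in Ioi 0, F u ≤ ∫ u in Ioi 0, (G₁ u + G₂ u + G₃ u) := hmono
    _ = (∫ u in Ioi 0, G₁ u) + (∫ u in Ioi 0, G₂ u) + ∫ u in Ioi 0, G₃ u := hsplit
    _ ≤ a * C₄ + 2 * b / Real.sqrt C₄ + 2 * d / Real.sqrt ω' := by rw [hE₂, hE₃]; linarith



/-- The threshold `C₄ = C₄(C) ≥ 4` of (5.8): `(2 log u)^C ≤ u^{1/4}` for `u ≥ C₄`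
(`(log x)^C = o(x^{1/4})`, Mathlib's `isLittleO_log_rpow_rpow_atTop`).
[cite: GoldstonPintzYildirim2009, Lemma 1 eq. 5.8] -/
theorem exists_threshold (C : ℝ) :
    ∃ C₄ : ℝ, 4 ≤ C₄ ∧ ∀ u : ℝ, C₄ ≤ u → (2 * Real.log u) ^ C ≤ u ^ (1 / 4 : ℝ) := by
  have hlo := isLittleO_log_rpow_rpow_atTop C (by norm_num : (0 : ℝ) < 1 / 4)
  have h2C : (0 : ℝ) < (2 : ℝ) ^ (-C) := Real.rpow_pos_of_pos (by norm_num) _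
  have hev := hlo.def h2C
  rw [Filter.eventually_atTop] at hev
  obtain ⟨N, hN⟩ := hev
  refine ⟨max N 4, le_max_right _ _, fun u hu => ?_⟩
  have hu4 : 4 ≤ u := le_trans (le_max_right _ _) hu
  have hlog : 0 < Real.log u := Real.log_pos (by linarith)
  have h := hN u (le_trans (le_max_left _ _) hu)
  rw [Real.norm_of_nonneg (Real.rpow_nonneg hlog.le _),
    Real.norm_of_nonneg (Real.rpow_nonneg (by linarith) _)] at h
  rw [Real.mul_rpow (by norm_num) hlog.le]
  calc (2 : ℝ) ^ C * Real.log u ^ C ≤ (2 : ℝ) ^ C * ((2 : ℝ) ^ (-C) * u ^ (1 / 4 : ℝ)) :=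
        mul_le_mul_of_nonneg_left h (Real.rpow_nonneg (by norm_num) _)
    _ = u ^ (1 / 4 : ℝ) := by
        rw [← mul_assoc, ← Real.rpow_add (by norm_num), add_neg_cancel, Real.rpow_zero, one_mul]

/-- For `u ≥ C₄`, `k ≥ 2`, `0 ≤ B ≤ Ck`: `(log(u+4))^B / u^k ≤ u^{−3/2}` (the `t^{−3/2}` of (5.8):
`(log(u+4))^B ≤ (2 log u)^{Ck} ≤ u^{k/4} ≤ u^{k − 3/2}`).
[cite: GoldstonPintzYildirim2009, Lemma 1 eq. 5.8] -/
theorem tail_bound {C C₄ : ℝ} (hC₄ : 4 ≤ C₄)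
    (hthr : ∀ u : ℝ, C₄ ≤ u → (2 * Real.log u) ^ C ≤ u ^ (1 / 4 : ℝ))
    {u : ℝ} (hu : C₄ ≤ u) {k : ℕ} (hk : 2 ≤ k) {B : ℝ} (hB0 : 0 ≤ B) (hB : B ≤ C * k) :
    Real.log (u + 4) ^ B / u ^ k ≤ u ^ (-(3 / 2 : ℝ)) := by
  have hu4 : 4 ≤ u := hC₄.trans hu
  have hu0 : 0 < u := by linarith
  have hlogu : Real.log 4 ≤ Real.log u := Real.log_le_log (by norm_num) hu4
  have hlog4 : 1 < Real.log 4 := by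
    rw [← Real.exp_lt_exp, Real.exp_log (by norm_num)]
    have := Real.exp_one_lt_d9
    linarith
  have hbase : 1 ≤ 2 * Real.log u := by linarith
  -- log(u+4) ≤ 2 log u
  have h1 : Real.log (u + 4) ≤ 2 * Real.log u := by
    have : u + 4 ≤ u ^ 2 := by nlinarith
    calc Real.log (u + 4) ≤ Real.log (u ^ 2) := Real.log_le_log (by linarith) this
      _ = 2 * Real.log u := by rw [Real.log_pow]; norm_num
  have hl0 : 0 < Real.log (u + 4) := Real.log_pos (by linarith)
  -- (log(u+4))^B ≤ (2 log u)^B ≤ (2 log u)^{Ck} = ((2 log u)^C)^k ≤ u^{k/4}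
  have h2 : Real.log (u + 4) ^ B ≤ (2 * Real.log u) ^ (C * k) :=
    calc Real.log (u + 4) ^ B ≤ (2 * Real.log u) ^ B := Real.rpow_le_rpow hl0.le h1 hB0
      _ ≤ (2 * Real.log u) ^ (C * k) := Real.rpow_le_rpow_of_exponent_le hbase hB
  have h3 : (2 * Real.log u) ^ (C * k) ≤ u ^ ((k : ℝ) / 4) := by
    rw [Real.rpow_mul (by linarith), Real.rpow_natCast]
    calc ((2 * Real.log u) ^ C) ^ k ≤ (u ^ (1 / 4 : ℝ)) ^ k :=
          pow_le_pow_left₀ (Real.rpow_nonneg (by linarith) _) (hthr u hu) k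
      _ = u ^ ((k : ℝ) / 4) := by
          rw [← Real.rpow_natCast, ← Real.rpow_mul hu0.le]
          ring_nf
  have hk2 : (2 : ℝ) ≤ k := by exact_mod_cast hk
  rw [div_le_iff₀ (by positivity)]
  calc Real.log (u + 4) ^ B ≤ u ^ ((k : ℝ) / 4) := h2.trans h3
    _ ≤ u ^ (-(3 / 2 : ℝ) + k) := Real.rpow_le_rpow_of_exponent_le (by linarith) (by linarith)
    _ = u ^ (-(3 / 2 : ℝ)) * u ^ k := by
        rw [Real.rpow_add hu0, Real.rpow_natCast]


/-! ### Symmetry and pointwise bounds of the integrand -/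

/-- `|s(|t|)| = |s(t)|`: the integrand of Lemma 1 is even in `t`. [folklore] -/
theorem norm_contourL_abs (cbar t : ℝ) : ‖contourL cbar |t|‖ = ‖contourL cbar t‖ := by
  rw [Complex.norm_eq_sqrt_sq_add_sq, Complex.norm_eq_sqrt_sq_add_sq]
  simp [contourL_re, contourL_im, abs_abs, sq_abs]

/-- The integrand of Lemma 1 is even in `t`. [folklore] -/
theorem lemma1Integrand_abs (cbar R B : ℝ) (k : ℕ) (t : ℝ) :
    lemma1Integrand cbar R B k |t| = lemma1Integrand cbar R B k t := by
  unfold lemma1Integrand contourLSpeed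
  rw [norm_contourL_abs, contourL_re, contourL_re, abs_abs]

/-- `∫_ℒ = 2 ∫_{t > 0}` (the first line of (5.8)).
[cite: GoldstonPintzYildirim2009, Lemma 1 eq. 5.8] -/
theorem lemma1Integral_eq (cbar R B : ℝ) (k : ℕ) :
    lemma1Integral cbar R B k = 2 * ∫ u in Ioi 0, lemma1Integrand cbar R B k u := by
  unfold lemma1Integral
  rw [← integral_comp_abs]
  simp_rw [lemma1Integrand_abs]

/-- The generic pointwise bound on `t = u > 0`: if `R^{Re s(u)} ≤ ρ` then the integrand is at most
`2 (log(u+4))^B ρ / |s(u)|^k` (`|ds/dt| ≤ 2`, `log(|s|+3) ≤ log(u+4)`, `B ≥ 0`).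
[cite: GoldstonPintzYildirim2009, Lemma 1 eq. 5.8] -/
theorem lemma1Integrand_le (hc0 : 0 < cbar) (hc1 : cbar ≤ 1) {R ρ : ℝ} (hR : 0 ≤ R) {B : ℝ}
    (hB : 0 ≤ B) (k : ℕ) {u : ℝ} (hu : 0 < u) (hρ : R ^ (contourL cbar u).re ≤ ρ) :
    lemma1Integrand cbar R B k u ≤ 2 * (Real.log (u + 4) ^ B * (ρ / ‖contourL cbar u‖ ^ k)) := by
  unfold lemma1Integrand
  have hn := norm_contourL_pos hc0 u
  have hL1 := one_lt_log_norm_contourL_add_three cbar u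
  have hlog : Real.log (‖contourL cbar u‖ + 3) ^ B ≤ Real.log (u + 4) ^ B := by
    refine Real.rpow_le_rpow (by linarith) ?_ hB
    have := log_norm_contourL_add_three_le hc0.le hc1 u
    rwa [abs_of_pos hu] at this
  have h1 : 0 ≤ Real.log (u + 4) ^ B := Real.rpow_nonneg (Real.log_nonneg (by linarith)) _
  have hfrac : R ^ (contourL cbar u).re / ‖contourL cbar u‖ ^ k ≤ ρ / ‖contourL cbar u‖ ^ k :=
    div_le_div_of_nonneg_right hρ (by positivity)
  have hfrac0 : 0 ≤ R ^ (contourL cbar u).re / ‖contourL cbar u‖ ^ k :=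
    div_nonneg (Real.rpow_nonneg hR _) (by positivity)
  have hsp := contourLSpeed_le_two hc0.le hc1 u
  have hsp0 := contourLSpeed_nonneg cbar u
  have hl0 : 0 ≤ Real.log (‖contourL cbar u‖ + 3) ^ B := Real.rpow_nonneg (by linarith) _
  calc Real.log (‖contourL cbar u‖ + 3) ^ B * (R ^ (contourL cbar u).re / ‖contourL cbar u‖ ^ k) *
        contourLSpeed cbar u
      ≤ Real.log (u + 4) ^ B * (ρ / ‖contourL cbar u‖ ^ k) * 2 := by
        apply mul_le_mul (mul_le_mul hlog hfrac hfrac0 h1) hsp hsp0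
        exact mul_nonneg h1 (le_trans hfrac0 hfrac)
    _ = _ := by ring

/-- Bounded range `0 < u ≤ C₄`: `(log(u+4))^B / |s(u)|^k ≤ C₁^k` with
`C₁ = (log(C₄+4))^C · log(C₄+3)/c̄` (`|s(u)| ≥ c̄/log(u+3)`; the `C₁^k` of (5.6)).
[cite: GoldstonPintzYildirim2009, Lemma 1 eq. 5.8] -/
theorem head_bound (hc0 : 0 < cbar) {C C₄ : ℝ} (hC₄ : 4 ≤ C₄) {u : ℝ} (hu0 : 0 < u) (hu : u ≤ C₄)
    {k : ℕ} {B : ℝ} (hB0 : 0 ≤ B) (hB : B ≤ C * k) :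
    Real.log (u + 4) ^ B * (1 / ‖contourL cbar u‖ ^ k) ≤
      (Real.log (C₄ + 4) ^ C * (Real.log (C₄ + 3) / cbar)) ^ k := by
  have hl8 : 1 ≤ Real.log (C₄ + 4) := by
    have : 1 < Real.log (|C₄| + 3) := LFunctions.ZetaClassicalRegion.one_lt_log_abs_add_three C₄
    rw [abs_of_pos (by linarith)] at this
    linarith [Real.log_le_log (by linarith : (0:ℝ) < C₄ + 3) (by linarith : C₄ + 3 ≤ C₄ + 4)]
  have hlu : 0 < Real.log (u + 4) := Real.log_pos (by linarith)
  -- the log power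
  have h1 : Real.log (u + 4) ^ B ≤ (Real.log (C₄ + 4) ^ C) ^ k := by
    calc Real.log (u + 4) ^ B ≤ Real.log (C₄ + 4) ^ B :=
          Real.rpow_le_rpow hlu.le (Real.log_le_log (by linarith) (by linarith)) hB0
      _ ≤ Real.log (C₄ + 4) ^ (C * k) := Real.rpow_le_rpow_of_exponent_le hl8 hB
      _ = (Real.log (C₄ + 4) ^ C) ^ k := by rw [Real.rpow_mul (by linarith), Real.rpow_natCast]
  -- the reciprocal of the norm
  have hn := norm_contourL_pos hc0 u
  have hlo := div_log_le_norm_contourL hc0.le u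
  rw [abs_of_pos hu0] at hlo
  have hL3 : 0 < Real.log (u + 3) := Real.log_pos (by linarith)
  have h2 : 1 / ‖contourL cbar u‖ ^ k ≤ (Real.log (C₄ + 3) / cbar) ^ k := by
    rw [one_div, ← inv_pow]
    apply pow_le_pow_left₀ (inv_nonneg.2 hn.le)
    rw [inv_le_comm₀ hn (div_pos (by
      have : 1 < Real.log (|C₄| + 3) := LFunctions.ZetaClassicalRegion.one_lt_log_abs_add_three C₄
      rw [abs_of_pos (by linarith)] at this; linarith) hc0)]
    calc (Real.log (C₄ + 3) / cbar)⁻¹ = cbar / Real.log (C₄ + 3) := by rw [inv_div]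
      _ ≤ cbar / Real.log (u + 3) := by
          apply div_le_div_of_nonneg_left hc0.le hL3
          exact Real.log_le_log (by linarith) (by linarith)
      _ = cbar / Real.log (|u| + 3) := by rw [abs_of_pos hu0]
      _ ≤ ‖contourL cbar u‖ := div_log_le_norm_contourL hc0.le u
  have h10 : 0 ≤ (Real.log (C₄ + 4) ^ C) ^ k := pow_nonneg (Real.rpow_nonneg (by linarith) _) _
  calc Real.log (u + 4) ^ B * (1 / ‖contourL cbar u‖ ^ k)
      ≤ (Real.log (C₄ + 4) ^ C) ^ k * (Real.log (C₄ + 3) / cbar) ^ k :=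
        mul_le_mul h1 h2 (by positivity) h10
    _ = _ := by rw [← mul_pow]

/-! ### Lemma 1 -/

/-- Unbounded range `u > C₄`: if `R^{Re s(u)} ≤ ρ` then the integrand is at most `2ρ u^{−3/2}`
(`|s(u)| ≥ u` and `tail_bound`). [cite: GoldstonPintzYildirim2009, Lemma 1 eq. 5.8] -/
theorem lemma1Integrand_le_tail (hc0 : 0 < cbar) (hc1 : cbar ≤ 1) {R : ℝ} (hR : 0 ≤ R) {C C₄ : ℝ}
    (hC₄ : 4 ≤ C₄) (hthr : ∀ u : ℝ, C₄ ≤ u → (2 * Real.log u) ^ C ≤ u ^ (1 / 4 : ℝ))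
    {k : ℕ} (hk : 2 ≤ k) {B : ℝ} (hB0 : 0 ≤ B) (hB : B ≤ C * k) {ρ u : ℝ} (hu : C₄ < u)
    (hρ : R ^ (contourL cbar u).re ≤ ρ) (hρ0 : 0 ≤ ρ) :
    lemma1Integrand cbar R B k u ≤ 2 * ρ * u ^ (-(3 / 2 : ℝ)) := by
  have hu0 : 0 < u := by linarith
  have h := lemma1Integrand_le hc0 hc1 hR hB0 k hu0 hρ
  have hn : u ≤ ‖contourL cbar u‖ := by
    have := abs_le_norm_contourL cbar u
    rwa [abs_of_pos hu0] at this
  have ht := tail_bound hC₄ hthr hu.le hk hB0 hB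
  have hl0 : 0 ≤ Real.log (u + 4) ^ B := Real.rpow_nonneg (Real.log_nonneg (by linarith)) _
  calc lemma1Integrand cbar R B k u
      ≤ 2 * (Real.log (u + 4) ^ B * (ρ / ‖contourL cbar u‖ ^ k)) := h
    _ ≤ 2 * (Real.log (u + 4) ^ B * (ρ / u ^ k)) := by
        apply mul_le_mul_of_nonneg_left _ (by norm_num)
        apply mul_le_mul_of_nonneg_left _ hl0
        exact div_le_div_of_nonneg_left hρ0 (by positivity) (pow_le_pow_left₀ hu0.le hn k)
    _ = 2 * ρ * (Real.log (u + 4) ^ B / u ^ k) := by ring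
    _ ≤ 2 * ρ * u ^ (-(3 / 2 : ℝ)) := mul_le_mul_of_nonneg_left ht (by positivity)

/-! ### Integrability of the integrand -/

/-- The parametrisation of `ℒ` is continuous. [folklore] -/
theorem continuous_contourL (cbar : ℝ) : Continuous fun t : ℝ => contourL cbar t := by
  have hlog : Continuous fun t : ℝ => Real.log (|t| + 3) :=
    Continuous.log (by fun_prop) fun t => by linarith [abs_nonneg t]
  have hre : Continuous fun t : ℝ => -(cbar / Real.log (|t| + 3)) :=
    (continuous_const.div hlog fun t => by
      linarith [LFunctions.ZetaClassicalRegion.one_lt_log_abs_add_three t]).neg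
  have h : Continuous fun t : ℝ =>
      ((-(cbar / Real.log (|t| + 3)) : ℝ) : ℂ) + (t : ℂ) * Complex.I := by
    fun_prop
  convert h using 1
  funext t
  apply Complex.ext <;> simp [contourL]

/-- The speed `|ds/dt|` is continuous. [folklore] -/
theorem continuous_contourLSpeed (cbar : ℝ) : Continuous fun t : ℝ => contourLSpeed cbar t := by
  unfold contourLSpeed
  have hlog : Continuous fun t : ℝ => Real.log (|t| + 3) :=
    Continuous.log (by fun_prop) fun t => by linarith [abs_nonneg t]
  have hden : Continuous fun t : ℝ => (|t| + 3) * Real.log (|t| + 3) ^ 2 := by fun_prop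
  have hden0 : ∀ t : ℝ, (|t| + 3) * Real.log (|t| + 3) ^ 2 ≠ 0 := fun t => by
    have := LFunctions.ZetaClassicalRegion.one_lt_log_abs_add_three t
    have h3 : 0 < |t| + 3 := by linarith [abs_nonneg t]
    positivity
  exact Real.continuous_sqrt.comp (continuous_const.add ((continuous_const.div hden hden0).pow 2))

/-- The integrand of Lemma 1 is continuous in `t` (`c̄ > 0`, `R > 0`). [folklore] -/
theorem continuous_lemma1Integrand (hc0 : 0 < cbar) {R : ℝ} (hR : 0 < R) (B : ℝ) (k : ℕ) :
    Continuous (lemma1Integrand cbar R B k) := by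
  unfold lemma1Integrand
  have hγ := continuous_contourL cbar
  have hnorm : Continuous fun t : ℝ => ‖contourL cbar t‖ := continuous_norm.comp hγ
  have hn0 : ∀ t, ‖contourL cbar t‖ ≠ 0 := fun t => (norm_contourL_pos hc0 t).ne'
  have hlog : Continuous fun t : ℝ => Real.log (‖contourL cbar t‖ + 3) :=
    Continuous.log (hnorm.add continuous_const) fun t => by linarith [norm_nonneg (contourL cbar t)]
  have hpowB : Continuous fun t : ℝ => Real.log (‖contourL cbar t‖ + 3) ^ B :=
    hlog.rpow_const fun t => Or.inl (by
      linarith [one_lt_log_norm_contourL_add_three cbar t])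
  have hre : Continuous fun t : ℝ => (contourL cbar t).re := Complex.continuous_re.comp hγ
  have hR : Continuous fun t : ℝ => R ^ (contourL cbar t).re := by
    have : (fun t : ℝ => R ^ (contourL cbar t).re) =
        fun t => Real.exp (Real.log R * (contourL cbar t).re) := by
      funext t; rw [Real.rpow_def_of_pos hR]
    rw [this]
    exact Real.continuous_exp.comp (continuous_const.mul hre)
  have hfrac : Continuous fun t : ℝ => R ^ (contourL cbar t).re / ‖contourL cbar t‖ ^ k :=
    hR.div (hnorm.pow k) fun t => pow_ne_zero _ (hn0 t)
  exact (hpowB.mul hfrac).mul (continuous_contourLSpeed cbar)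

/-- The integrand is even in `t`. [folklore] -/
theorem lemma1Integrand_neg (cbar R B : ℝ) (k : ℕ) (t : ℝ) :
    lemma1Integrand cbar R B k (-t) = lemma1Integrand cbar R B k t := by
  rw [← lemma1Integrand_abs cbar R B k (-t), abs_neg, lemma1Integrand_abs]

/-- **Integrability**: the integrand of Lemma 1 is Bochner integrable on `ℝ` (`0 < c̄ ≤ 10⁻²`,
`R > 0`, `k ≥ 2`, `0 ≤ B ≤ Ck`), so that `lemma1Integral` is the genuine (absolutely convergent)
integral `∫_ℒ (log(|s|+3))^B |R^s/s^k ds|` of the source and bounds of the shape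
`‖∫_ℒ F(s) R^s s^{−k} ds‖ ≤ (sup |F| (log(|s|+3))^{−B}) · lemma1Integral` are available downstream
((6.18), Lemma 3). Continuity gives measurability; the majorant is `2ρC₁^k` on `|t| ≤ C₄` and
`2ρ|t|^{−3/2}` beyond, `ρ = max(1, R^{−c̄/log 3})`.
[cite: GoldstonPintzYildirim2009, Lemma 1 eq. 5.6] -/
theorem lemma1Integrand_integrable {cbar : ℝ} (hc0 : 0 < cbar) (hc1 : cbar ≤ 1 / 100) {C : ℝ}
    {R : ℝ} (hR : 0 < R) {k : ℕ} (hk : 2 ≤ k) {B : ℝ} (hB0 : 0 ≤ B) (hB : B ≤ C * k) :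
    Integrable (lemma1Integrand cbar R B k) := by
  have hc1' : cbar ≤ 1 := by linarith
  obtain ⟨C₄, hC₄4, hthr⟩ := exists_threshold C
  have hC₄0 : 0 < C₄ := by linarith
  set F := lemma1Integrand cbar R B k with hFdef
  -- a uniform bound `ρ` for `R^{Re s}` on `ℒ`
  set ρ : ℝ := max 1 (R ^ (-(cbar / Real.log 3))) with hρdef
  have hρ0 : 0 ≤ ρ := le_trans zero_le_one (le_max_left _ _)
  have hρ : ∀ u : ℝ, R ^ (contourL cbar u).re ≤ ρ := by
    intro u
    rcases le_or_gt 1 R with hR1 | hR1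
    · exact (rpow_re_le_one hR1 hc0.le u).trans (le_max_left _ _)
    · exact (rpow_re_le_of_le_one hR hR1.le hc0.le u).trans (le_max_right _ _)
  set C₁ : ℝ := Real.log (C₄ + 4) ^ C * (Real.log (C₄ + 3) / cbar) with hC₁def
  -- pointwise bounds on `(0, ∞)`
  have hhead : ∀ u, 0 < u → u ≤ C₄ → F u ≤ 2 * ρ * C₁ ^ k := by
    intro u hu0 hu
    have h := lemma1Integrand_le hc0 hc1' hR.le hB0 k hu0 (hρ u)
    have hh := head_bound hc0 (C := C) hC₄4 hu0 hu hB0 hB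
    calc F u ≤ 2 * (Real.log (u + 4) ^ B * (ρ / ‖contourL cbar u‖ ^ k)) := h
      _ = 2 * ρ * (Real.log (u + 4) ^ B * (1 / ‖contourL cbar u‖ ^ k)) := by ring
      _ ≤ 2 * ρ * C₁ ^ k := mul_le_mul_of_nonneg_left hh (by positivity)
  have htail : ∀ u, C₄ < u → F u ≤ 2 * ρ * u ^ (-(3 / 2 : ℝ)) := fun u hu =>
    lemma1Integrand_le_tail hc0 hc1' hR.le hC₄4 hthr hk hB0 hB hu (hρ u) hρ0
  have hF0 : ∀ u, 0 ≤ F u := fun u => lemma1Integrand_nonneg cbar hR.le B k u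
  have hcont : Continuous F := continuous_lemma1Integrand hc0 hR B k
  -- integrability on `(0, ∞)` by domination
  have hIoi : IntegrableOn F (Ioi 0) := by
    set G : ℝ → ℝ := fun u => (Iic C₄).indicator (fun _ => 2 * ρ * C₁ ^ k) u +
      (Ioi C₄).indicator (fun u => 2 * ρ * u ^ (-(3 / 2 : ℝ))) u with hGdef
    have hG : Integrable G (volume.restrict (Ioi (0 : ℝ))) := by
      refine Integrable.add ?_ ?_
      · rw [integrable_indicator_iff measurableSet_Iic]
        refine integrableOn_const ?_
        rw [Measure.restrict_apply measurableSet_Iic]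
        have : volume (Iic C₄ ∩ Ioi (0 : ℝ)) < ⊤ := by
          calc volume (Iic C₄ ∩ Ioi (0 : ℝ)) ≤ volume (Ioc (0 : ℝ) C₄) :=
                measure_mono fun x hx => ⟨hx.2, hx.1⟩
            _ < ⊤ := by rw [Real.volume_Ioc]; exact ENNReal.ofReal_lt_top
        exact this.ne
      · rw [integrable_indicator_iff measurableSet_Ioi]
        have : IntegrableOn (fun u : ℝ => 2 * ρ * u ^ (-(3 / 2 : ℝ))) (Ioi C₄) :=
          (integrableOn_Ioi_rpow_of_lt (by norm_num) hC₄0).const_mul _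
        exact this.mono_measure Measure.restrict_le_self
    refine Integrable.mono' hG hcont.aestronglyMeasurable ?_
    refine ae_restrict_of_forall_mem measurableSet_Ioi fun u hu => ?_
    have hu0 : 0 < u := hu
    rw [Real.norm_of_nonneg (hF0 u), hGdef]
    simp only [Set.indicator_apply, Set.mem_Iic, Set.mem_Ioi]
    rcases le_or_gt u C₄ with h | h
    · rw [if_pos h, if_neg (not_lt.2 h), add_zero]
      exact hhead u hu0 h
    · rw [if_neg (not_le.2 h), if_pos h, zero_add]
      exact htail u h
  -- the negative half-line by evenness
  have hIio : IntegrableOn F (Iio 0) := by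
    have hmp : MeasureTheory.MeasurePreserving (Neg.neg : ℝ → ℝ) volume volume :=
      Measure.measurePreserving_neg volume
    have hme : MeasurableEmbedding (Neg.neg : ℝ → ℝ) := (Homeomorph.neg ℝ).measurableEmbedding
    refine (hmp.integrableOn_comp_preimage hme (f := F) (s := Iio 0)).1 ?_
    have hcomp : F ∘ (Neg.neg : ℝ → ℝ) = F := funext fun x => lemma1Integrand_neg cbar R B k x
    have hpre : (Neg.neg : ℝ → ℝ) ⁻¹' Iio 0 = Ioi 0 := Set.ext fun x => by simp
    rw [hcomp, hpre]
    exact hIoi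
  have hIci : IntegrableOn F (Ici 0) :=
    (integrableOn_Ici_iff_integrableOn_Ioi (by exact ENNReal.coe_ne_top)).2 hIoi
  have huniv : IntegrableOn F Set.univ := by
    rw [← Set.Iio_union_Ici (a := (0 : ℝ))]
    exact hIio.union hIci
  exact integrableOn_univ.1 huniv

-- the proof of (5.6) keeps both ranges of `R` and all constants in one declaration
set_option maxHeartbeats 400000 in
/-- **GPY Lemma 1, (5.6)**: "for `R ≥ C`, `k ≥ 2`, `B ≤ Ck`,
`∫_ℒ (log(|s|+3))^B |R^s/s^k ds| ≪ C₁^k R^{−c₂} + e^{−√(c̄ log R)/2}`, where `C₁, c₂` and the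
implied constant depend only on `C`" (here also on the fixed `c̄ ∈ (0, 10⁻²]` of (5.3), as in the
source; `B ≥ 0` made explicit; implied constant `K`). Proof as printed, (5.8): the integrand is
`≪ R^{σ(t)} (log(|t|+4))^B/(|t| + c̄/2)^k`; split `[0, C₄]`, `[C₄, ω − 3]`, `[ω − 3, ∞)` with
`log ω = √(c̄ log R)`, giving `C₁^k R^{−c₂} + e^{−c̄ log R/log ω} + ω^{−1/2}`; for `C ≤ R < 1` the
bound is trivial (`R^{Re s} ≤ C^{−c̄/log 3}`). [cite: GoldstonPintzYildirim2009, Lemma 1 eq. 5.6] -/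
theorem lemma1_bound {cbar : ℝ} (hc0 : 0 < cbar) (hc1 : cbar ≤ 1 / 100) {C : ℝ} (hC : 0 < C) :
    ∃ C₁ c₂ K : ℝ, 1 ≤ C₁ ∧ 0 < c₂ ∧ 0 < K ∧ ∀ (R : ℝ) (k : ℕ) (B : ℝ),
      C ≤ R → 2 ≤ k → 0 ≤ B → B ≤ C * k →
        lemma1Integral cbar R B k ≤
          K * (C₁ ^ k * R ^ (-c₂) + Real.exp (-(Real.sqrt (cbar * Real.log R)) / 2)) := by
  have hc1' : cbar ≤ 1 := by linarith
  obtain ⟨C₄, hC₄4, hthr⟩ := exists_threshold C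
  have hC₄0 : 0 < C₄ := by linarith
  have hl7 : 1 < Real.log (C₄ + 3) := by
    have := LFunctions.ZetaClassicalRegion.one_lt_log_abs_add_three C₄
    rwa [abs_of_pos hC₄0] at this
  have hl8 : 1 ≤ Real.log (C₄ + 4) := by
    linarith [Real.log_le_log (by linarith : (0:ℝ) < C₄ + 3) (by linarith : C₄ + 3 ≤ C₄ + 4)]
  set C₁ : ℝ := Real.log (C₄ + 4) ^ C * (Real.log (C₄ + 3) / cbar) with hC₁def
  set c₂ : ℝ := cbar / Real.log (C₄ + 3) with hc₂def
  have hC₁1 : 1 ≤ C₁ := by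
    have h1 : 1 ≤ Real.log (C₄ + 4) ^ C := Real.one_le_rpow hl8 hC.le
    have h2 : 1 ≤ Real.log (C₄ + 3) / cbar := by
      rw [le_div_iff₀ hc0]; linarith
    calc (1 : ℝ) = 1 * 1 := by ring
      _ ≤ _ := mul_le_mul h1 h2 zero_le_one (by linarith)
  have hc₂0 : 0 < c₂ := div_pos hc0 (by linarith)
  set A : ℝ := max 1 (C ^ (-(cbar / Real.log 3))) with hAdef
  have hA1 : 1 ≤ A := le_max_left _ _
  set K : ℝ := max (4 * C₄) (4 + 8 * Real.sqrt 6) + 4 * A * (C₄ + 1) with hKdef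
  have hK0 : 0 < K := by positivity
  have hK1 : 4 * C₄ ≤ K := by
    have := le_max_left (4 * C₄) (4 + 8 * Real.sqrt 6)
    have : 0 ≤ 4 * A * (C₄ + 1) := by positivity
    linarith
  have hK2 : 4 + 8 * Real.sqrt 6 ≤ K := by
    have := le_max_right (4 * C₄) (4 + 8 * Real.sqrt 6)
    have : 0 ≤ 4 * A * (C₄ + 1) := by positivity
    linarith
  have hK3 : 4 * A * (C₄ + 1) ≤ K := by
    have : 0 ≤ max (4 * C₄) (4 + 8 * Real.sqrt 6) := le_trans (by positivity) (le_max_left _ _)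
    linarith
  refine ⟨C₁, c₂, K, hC₁1, hc₂0, hK0, fun R k B hR hk hB0 hB => ?_⟩
  have hR0 : 0 < R := hC.trans_le hR
  set E : ℝ := Real.exp (-(Real.sqrt (cbar * Real.log R)) / 2) with hEdef
  have hE0 : 0 < E := Real.exp_pos _
  have hC₁k : 1 ≤ C₁ ^ k := one_le_pow₀ hC₁1
  rw [lemma1Integral_eq]
  set F : ℝ → ℝ := lemma1Integrand cbar R B k with hFdef
  have hF0 : ∀ u, 0 < u → 0 ≤ F u := fun u _ => lemma1Integrand_nonneg cbar hR0.le B k u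
  -- the two pointwise regimes, for a bound `ρ` of `R^{σ(u)}`
  have hhead : ∀ (ρ : ℝ) (u : ℝ), 0 < u → u ≤ C₄ → R ^ (contourL cbar u).re ≤ ρ → 0 ≤ ρ →
      F u ≤ 2 * ρ * C₁ ^ k := by
    intro ρ u hu0 hu hρ hρ0
    have h := lemma1Integrand_le hc0 hc1' hR0.le hB0 k hu0 hρ
    have hh := head_bound hc0 (C := C) hC₄4 hu0 hu hB0 hB
    have hn := norm_contourL_pos hc0 u
    calc F u ≤ 2 * (Real.log (u + 4) ^ B * (ρ / ‖contourL cbar u‖ ^ k)) := h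
      _ = 2 * ρ * (Real.log (u + 4) ^ B * (1 / ‖contourL cbar u‖ ^ k)) := by ring
      _ ≤ 2 * ρ * C₁ ^ k := mul_le_mul_of_nonneg_left hh (by positivity)
  have htail : ∀ (ρ : ℝ) (u : ℝ), C₄ < u → R ^ (contourL cbar u).re ≤ ρ → 0 ≤ ρ →
      F u ≤ 2 * ρ * u ^ (-(3 / 2 : ℝ)) := fun ρ u hu hρ hρ0 =>
    lemma1Integrand_le_tail hc0 hc1' hR0.le hC₄4 hthr hk hB0 hB hu hρ hρ0
  rcases le_or_gt 1 R with hR1 | hR1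
  · -- main case `R ≥ 1`
    set L : ℝ := Real.log R with hLdef
    have hL0 : 0 ≤ L := Real.log_nonneg hR1
    set ω : ℝ := Real.exp (Real.sqrt (cbar * L)) with hωdef
    have hω1 : 1 ≤ ω := Real.one_le_exp (Real.sqrt_nonneg _)
    have hlogω : Real.log ω = Real.sqrt (cbar * L) := Real.log_exp _
    set ω' : ℝ := max C₄ (ω - 3) with hω'def
    have hω'C : C₄ ≤ ω' := le_max_left _ _
    -- `ρ₂ = R^{-c̄/log ω} = e^{-√(c̄ L)} ≤ E`
    set ρ₂ : ℝ := R ^ (-(cbar / Real.log ω)) with hρ₂def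
    have hρ₂0 : 0 ≤ ρ₂ := Real.rpow_nonneg hR0.le _
    have hρ₂E : ρ₂ ≤ E := by
      rw [hρ₂def, hlogω, Real.rpow_def_of_pos hR0, ← hLdef, hEdef, Real.exp_le_exp]
      rcases eq_or_lt_of_le hL0 with hL00 | hLpos
      · rw [← hL00]; simp
      · have hs : 0 < Real.sqrt (cbar * L) := Real.sqrt_pos.2 (by positivity)
        have hsq : Real.sqrt (cbar * L) ^ 2 = cbar * L := Real.sq_sqrt (by positivity)
        have : L * (-(cbar / Real.sqrt (cbar * L))) = -Real.sqrt (cbar * L) := by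
          calc L * (-(cbar / Real.sqrt (cbar * L)))
              = -((cbar * L) / Real.sqrt (cbar * L)) := by ring
            _ = -(Real.sqrt (cbar * L) ^ 2 / Real.sqrt (cbar * L)) := by rw [hsq]
            _ = -Real.sqrt (cbar * L) := by rw [pow_two, mul_self_div_self]
        rw [this]
        linarith
    -- apply the majorant lemma
    have hint := setIntegral_Ioi_le_of_majorant hF0 (a := 2 * R ^ (-c₂) * C₁ ^ k) (b := 2 * ρ₂)
      (d := 2) hC₄0 hω'C
      (fun u hu0 hu => hhead _ u hu0 hu (by
        rw [hc₂def]
        exact rpow_re_le_of_abs_le hR1 hc0.le (t := u) (T := C₄) (by rw [abs_of_pos hu0]; exact hu))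
        (Real.rpow_nonneg hR0.le _))
      (fun u hu hu' => by
        have hle : u ≤ ω - 3 := by
          rcases le_total C₄ (ω - 3) with h | h
          · rwa [hω'def, max_eq_right h] at hu'
          · rw [hω'def, max_eq_left h] at hu'; linarith
        have hρ : R ^ (contourL cbar u).re ≤ ρ₂ := by
          have := rpow_re_le_of_abs_le hR1 hc0.le (t := u) (T := ω - 3)
            (by rw [abs_of_pos (by linarith)]; exact hle)
          have e : ω - 3 + 3 = ω := by ring
          rw [e] at this
          exact this
        have := htail ρ₂ u hu hρ hρ₂0
        linarith)
      (fun u hu => by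
        have hu' : C₄ < u := lt_of_le_of_lt hω'C hu
        have := htail 1 u hu' (rpow_re_le_one hR1 hc0.le u) zero_le_one
        have hur : 0 ≤ u ^ (-(3 / 2 : ℝ)) := Real.rpow_nonneg (by linarith) _
        have : 0 ≤ 2 * ρ₂ * u ^ (-(3 / 2 : ℝ)) := by positivity
        linarith)
    -- numerical clean-up
    have hsq4 : 2 ≤ Real.sqrt C₄ := by
      rw [show (2 : ℝ) = Real.sqrt 4 by
        rw [show (4 : ℝ) = 2 ^ 2 by norm_num, Real.sqrt_sq (by norm_num)]]
      exact Real.sqrt_le_sqrt hC₄4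
    have hterm2 : 2 * (2 * ρ₂) / Real.sqrt C₄ ≤ 2 * E := by
      rw [div_le_iff₀ (by linarith)]
      have := mul_le_mul_of_nonneg_left hsq4 (by positivity : (0 : ℝ) ≤ 2 * E)
      linarith
    have hterm3 : 2 * 2 / Real.sqrt ω' ≤ 4 * Real.sqrt 6 * E := by
      -- `1/√ω' ≤ √6/√ω` and `1/√ω = E`
      have hEω : E = 1 / Real.sqrt ω := by
        rw [hEdef, hωdef, ← Real.exp_half, one_div, ← Real.exp_neg]
        congr 1; ring
      have hω0 : 0 < ω := by linarith
      have hsω : 0 < Real.sqrt ω := Real.sqrt_pos.2 hω0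
      have hsω' : 0 < Real.sqrt ω' := Real.sqrt_pos.2 (by linarith)
      have h6 : 0 < Real.sqrt 6 := Real.sqrt_pos.2 (by norm_num)
      have key : 1 / Real.sqrt ω' ≤ Real.sqrt 6 / Real.sqrt ω := by
        rw [div_le_div_iff₀ hsω' hsω, one_mul]
        rcases le_or_gt 6 ω with h6ω | h6ω
        · -- ω' ≥ ω - 3 ≥ ω/2
          have h1 : ω / 2 ≤ ω' := le_trans (by linarith) (le_max_right _ _)
          have h2 : Real.sqrt (ω / 2) ≤ Real.sqrt ω' := Real.sqrt_le_sqrt h1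
          have h3 : Real.sqrt ω = Real.sqrt 2 * Real.sqrt (ω / 2) := by
            rw [← Real.sqrt_mul (by norm_num)]; congr 1; ring
          have h4 : Real.sqrt 2 ≤ Real.sqrt 6 := Real.sqrt_le_sqrt (by norm_num)
          have h5 : 0 ≤ Real.sqrt (ω / 2) := Real.sqrt_nonneg _
          calc Real.sqrt ω = Real.sqrt 2 * Real.sqrt (ω / 2) := h3
            _ ≤ Real.sqrt 6 * Real.sqrt ω' := mul_le_mul h4 h2 h5 h6.le
        · -- ω < 6: √ω ≤ √6 ≤ √6 · √ω'
          have h1 : Real.sqrt ω ≤ Real.sqrt 6 := Real.sqrt_le_sqrt h6ω.le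
          have h2 : 2 ≤ Real.sqrt ω' := hsq4.trans (Real.sqrt_le_sqrt hω'C)
          calc Real.sqrt ω ≤ Real.sqrt 6 := h1
            _ ≤ Real.sqrt 6 * 2 := by linarith
            _ ≤ Real.sqrt 6 * Real.sqrt ω' := mul_le_mul_of_nonneg_left h2 h6.le
      calc 2 * 2 / Real.sqrt ω' = 4 * (1 / Real.sqrt ω') := by ring
        _ ≤ 4 * (Real.sqrt 6 / Real.sqrt ω) := by linarith
        _ = 4 * Real.sqrt 6 * E := by rw [hEω]; ring
    calc 2 * ∫ u in Ioi 0, F u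
        ≤ 2 * (2 * R ^ (-c₂) * C₁ ^ k * C₄ + 2 * (2 * ρ₂) / Real.sqrt C₄ +
            2 * 2 / Real.sqrt ω') := by
          linarith
      _ ≤ 2 * (2 * R ^ (-c₂) * C₁ ^ k * C₄ + 2 * E + 4 * Real.sqrt 6 * E) := by linarith
      _ = 4 * C₄ * (C₁ ^ k * R ^ (-c₂)) + (4 + 8 * Real.sqrt 6) * E := by ring
      _ ≤ K * (C₁ ^ k * R ^ (-c₂)) + K * E := by
          have h1 : 0 ≤ C₁ ^ k * R ^ (-c₂) := by positivity
          have h2 := mul_le_mul_of_nonneg_right hK1 h1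
          have h3 := mul_le_mul_of_nonneg_right hK2 hE0.le
          linarith
      _ = K * (C₁ ^ k * R ^ (-c₂) + E) := by ring
  · -- degenerate case `C ≤ R < 1`
    set ρ : ℝ := R ^ (-(cbar / Real.log 3)) with hρdef
    have hρA : ρ ≤ A := by
      refine le_trans ?_ (le_max_right _ _)
      exact Real.rpow_le_rpow_of_nonpos hC hR (by
        have : 1 < Real.log 3 := by
          have := LFunctions.ZetaClassicalRegion.one_lt_log_abs_add_three 0; simpa using this
        have := div_pos hc0 (zero_lt_one.trans this); linarith)
    have hA0 : 0 ≤ A := le_trans zero_le_one hA1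
    have hρu : ∀ u : ℝ, R ^ (contourL cbar u).re ≤ A := fun u =>
      (rpow_re_le_of_le_one hR0 hR1.le hc0.le u).trans hρA
    have hint := setIntegral_Ioi_le_of_majorant hF0 (a := 2 * A * C₁ ^ k) (b := 0) (d := 2 * A)
      hC₄0 le_rfl
      (fun u hu0 hu => hhead A u hu0 hu (hρu u) hA0)
      (fun u hu hu' => absurd (lt_of_lt_of_le hu hu') (lt_irrefl _))
      (fun u hu => by
        have := htail A u hu (hρu u) hA0
        linarith)
    have hsq4 : 2 ≤ Real.sqrt C₄ := by
      rw [show (2 : ℝ) = Real.sqrt 4 by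
        rw [show (4 : ℝ) = 2 ^ 2 by norm_num, Real.sqrt_sq (by norm_num)]]
      exact Real.sqrt_le_sqrt hC₄4
    have hterm : 2 * (2 * A) / Real.sqrt C₄ ≤ 2 * A := by
      rw [div_le_iff₀ (by linarith)]
      have := mul_le_mul_of_nonneg_left hsq4 (by positivity : (0 : ℝ) ≤ 2 * A)
      linarith
    have hRc : 1 ≤ R ^ (-c₂) := Real.one_le_rpow_of_pos_of_le_one_of_nonpos hR0 hR1.le (by linarith)
    calc 2 * ∫ u in Ioi 0, F u
        ≤ 2 * (2 * A * C₁ ^ k * C₄ + 2 * 0 / Real.sqrt C₄ + 2 * (2 * A) / Real.sqrt C₄) := by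
          linarith
      _ ≤ 2 * (2 * A * C₁ ^ k * C₄ + 2 * A) := by rw [mul_zero, zero_div, add_zero]; linarith
      _ ≤ 4 * A * (C₄ + 1) * C₁ ^ k := by
          have := mul_le_mul_of_nonneg_left hC₁k (by positivity : (0 : ℝ) ≤ 4 * A)
          nlinarith
      _ ≤ K * (C₁ ^ k * R ^ (-c₂)) := by
          have h1 : 4 * A * (C₄ + 1) * C₁ ^ k ≤ K * C₁ ^ k :=
            mul_le_mul_of_nonneg_right hK3 (by positivity)
          have h2 : K * C₁ ^ k ≤ K * (C₁ ^ k * R ^ (-c₂)) := by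
            apply mul_le_mul_of_nonneg_left _ hK0.le
            exact le_mul_of_one_le_right (by positivity) hRc
          linarith
      _ ≤ K * (C₁ ^ k * R ^ (-c₂) + E) := by
          rw [mul_add]
          linarith [mul_pos hK0 hE0]

/-- **GPY Lemma 1, (5.7)**: "if `k ≤ c₃ log R` with a sufficiently small `c₃` depending only on `C`,
then `∫_ℒ (log(|s|+3))^B |R^s/s^k ds| ≪ e^{−√(c̄ log R)/2}`" — from (5.6) with
`c₃ = c₂/(2 log max(C₁, e))`: `C₁^k R^{−c₂} ≤ e^{−c₂ log R/2} ≤ e^{c̄/(8c₂)} e^{−√(c̄ log R)/2}`.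
[cite: GoldstonPintzYildirim2009, Lemma 1 eq. 5.7] -/
theorem lemma1_bound_of_le_log {cbar : ℝ} (hc0 : 0 < cbar) (hc1 : cbar ≤ 1 / 100) {C : ℝ}
    (hC : 0 < C) :
    ∃ c₃ K : ℝ, 0 < c₃ ∧ 0 < K ∧ ∀ (R : ℝ) (k : ℕ) (B : ℝ),
      C ≤ R → 2 ≤ k → 0 ≤ B → B ≤ C * k → (k : ℝ) ≤ c₃ * Real.log R →
        lemma1Integral cbar R B k ≤ K * Real.exp (-(Real.sqrt (cbar * Real.log R)) / 2) := by
  obtain ⟨C₁, c₂, K, hC₁, hc₂, hK, hmain⟩ := lemma1_bound hc0 hc1 hC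
  set C₁' : ℝ := max C₁ (Real.exp 1) with hC₁'def
  have hC₁'e : Real.exp 1 ≤ C₁' := le_max_right _ _
  have hC₁'0 : 0 < C₁' := lt_of_lt_of_le (Real.exp_pos 1) hC₁'e
  have hlogC : 1 ≤ Real.log C₁' := by
    rw [← Real.log_exp 1]
    exact Real.log_le_log (Real.exp_pos 1) hC₁'e
  set c₃ : ℝ := c₂ / (2 * Real.log C₁') with hc₃def
  have hc₃0 : 0 < c₃ := by positivity
  set M : ℝ := Real.exp (cbar / (8 * c₂)) with hMdef
  refine ⟨c₃, K * (M + 1), hc₃0, by positivity, fun R k B hR hk hB0 hB hkR => ?_⟩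
  have hR0 : 0 < R := hC.trans_le hR
  set L : ℝ := Real.log R with hLdef
  have hk2 : (2 : ℝ) ≤ k := by exact_mod_cast hk
  have hcL : 0 < c₃ * L := lt_of_lt_of_le (by linarith) hkR
  have hL0 : 0 < L := by
    by_contra h
    push Not at h
    have : c₃ * L ≤ 0 := mul_nonpos_of_nonneg_of_nonpos hc₃0.le h
    linarith
  have h1 := hmain R k B hR hk hB0 hB
  set E : ℝ := Real.exp (-(Real.sqrt (cbar * L)) / 2) with hEdef
  have hE0 : 0 < E := Real.exp_pos _
  -- `C₁^k R^{-c₂} ≤ exp(-c₂ L/2)`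
  have hstep : C₁ ^ k * R ^ (-c₂) ≤ Real.exp (-(c₂ * L) / 2) := by
    have e1 : C₁ ^ k ≤ C₁' ^ k := pow_le_pow_left₀ (by linarith) (le_max_left _ _) k
    have e2 : C₁' ^ k = Real.exp (k * Real.log C₁') := by
      rw [← Real.rpow_natCast, Real.rpow_def_of_pos hC₁'0, mul_comm]
    have e3 : R ^ (-c₂) = Real.exp (-(c₂ * L)) := by
      rw [Real.rpow_def_of_pos hR0, hLdef]
      ring_nf
    have e4 : (k : ℝ) * Real.log C₁' ≤ c₂ * L / 2 := by
      calc (k : ℝ) * Real.log C₁' ≤ c₃ * L * Real.log C₁' :=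
            mul_le_mul_of_nonneg_right hkR (by linarith)
        _ = c₂ * L / 2 := by rw [hc₃def]; field_simp
    calc C₁ ^ k * R ^ (-c₂) ≤ C₁' ^ k * R ^ (-c₂) :=
          mul_le_mul_of_nonneg_right e1 (Real.rpow_nonneg hR0.le _)
      _ = Real.exp (k * Real.log C₁' + -(c₂ * L)) := by rw [e2, e3, Real.exp_add]
      _ ≤ Real.exp (-(c₂ * L) / 2) := Real.exp_le_exp.2 (by linarith)
  -- `exp(-c₂ L/2) ≤ M exp(-√(c̄ L)/2)`: the maximum of `√(c̄L)/2 − c₂L/2` is `c̄/(8c₂)`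
  have hstep2 : Real.exp (-(c₂ * L) / 2) ≤ M * E := by
    rw [hMdef, hEdef, ← Real.exp_add, Real.exp_le_exp]
    set x : ℝ := Real.sqrt (cbar * L) with hxdef
    have hx : x ^ 2 = cbar * L := Real.sq_sqrt (by positivity)
    have key0 : 0 ≤ cbar ^ 2 - 4 * cbar * c₂ * x + 4 * c₂ ^ 2 * (cbar * L) := by
      nlinarith [sq_nonneg (cbar - 2 * c₂ * x)]
    have key : x / 2 - c₂ * L / 2 ≤ cbar / (8 * c₂) := by
      rw [le_div_iff₀ (by positivity)]
      nlinarith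
    linarith
  calc lemma1Integral cbar R B k ≤ K * (C₁ ^ k * R ^ (-c₂) + E) := h1
    _ ≤ K * (M * E + E) := by
        apply mul_le_mul_of_nonneg_left _ hK.le
        linarith [hstep.trans hstep2]
    _ = K * (M + 1) * E := by ring

end Literature.NumberTheory.Sieve.GPY
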